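import Literature.Analysis.FluidPDE.PassiveScalarDiagEnergyRepresentative
import Literature.Analysis.FluidPDE.PassiveScalarDiagForcedTrace
import Literature.Analysis.FluidPDE.PassiveScalarDiagForcedCongr
import Literature.Analysis.FluidPDE.UniversalTotalAnomalousDissipatorProofs
import HarnessLib

/-!
# Every weak passive scalar with constant diagonal diffusion, bounded drift and an `L¹_t L²_x`
# source is (a.e. in time equal to) a solution in `C([0,T]; L²(T^d))` satisfying the energy
# equality at every pair of times

Analysis/FluidPDE proof file (everything proved; no definitions, no named facts). For `κ > 0`,
`aᵢ > 0`, `θ₀ ∈ L²(T^d)`, `u ∈ L^∞((0,T) × T^d)` (weakly divergence free for a.e. `t`, part of the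
class) and `∫₀ᵀ ‖s(t)‖_{L²} dt < ∞`, and a weak solution `θ` of
`∂ₜθ + u·∇θ = κ ∑ᵢ aᵢ ∂ᵢ∂ᵢθ + s` on `T^d × [0,T)` (`Torus.IsWeakScalarTransportDiagForcedOn`, the
DiPerna–Lions class with the constant diagonal diffusion of a rectangular flat torus written on
the unit torus, Hess-Childs–Rowan 2025 App. A):

* `IsWeakScalarTransportDiagForcedOn.exists_l2Continuous_representative` — there is a weak
  solution `w` of the same problem with `w(t) = θ(t)` a.e. for a.e. `t ∈ (0,T)`, `w(0) = θ₀`, and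
  `w ∈ C([0,T]; L²)` STRONGLY (`Torus.IsL2ContinuousOn (Icc 0 T) w`, the binder of the
  Hess-Childs–Rowan statements), satisfying the energy EQUALITY between EVERY pair of times
  `0 ≤ t₁ ≤ t₂ ≤ T`: `‖w(t₂)‖² + 2κ∫_{t₁}^{t₂}‖∇w‖²_a = ‖w(t₁)‖² + 2∫_{t₁}^{t₂}∫ s w`
  (Temam 1979, Ch. III §1 Lemma 1.2: `u ∈ L²(V)`, `u' ∈ L²(V')` ⇒ `u ∈ C([0,T];H)` and
  `d/dt|u|² = 2⟨u',u⟩`; here: the weakly continuous representative of `PassiveScalarDiagForcedTrace`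
  has the energy equality at every time, `PassiveScalarDiagEnergyRepresentative`, so `t ↦ ‖w(t)‖²`
  is continuous, and weak continuity plus continuity of the norm is strong continuity — the
  Radon–Riesz property of Hilbert space, Brezis 2011 Prop. 3.32);
* `IsWeakScalarTransportDiagForcedOn.energy_eq_of_isL2ContinuousOn`,
  `….energy_eq_sub_of_isL2ContinuousOn`, `….zero_ae_eq_of_isL2ContinuousOn` — for ANY weak solution
  which is `L²`-continuous on `[0,T]` (e.g. the solutions of `PassiveScalarDiagExistence`): the
  energy equality from `0` at EVERY `t ∈ [0,T]`, between every pair of times, and `θ(0) = θ₀` a.e.;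
* tools: `Torus.IsL2ContinuousOn.continuousOn_integral_mul` (strong ⇒ weak continuity),
  `Torus.IsL2ContinuousOn.continuousOn_integral_sq`, and the Radon–Riesz step
  `Torus.isL2ContinuousOn_of_weaklyContinuous`.

What is NOT here: existence for the forced class; uniqueness (`PassiveScalarDiagUniqueness`); the
global-in-time version (`PassiveScalarDiagEnergyContinuityGlobal`).

## Mathlib / tree search

Tree (reused): `IsWeakScalarTransportDiagForcedOn.exists_weaklyContinuous_representative`
(`PassiveScalarDiagForcedTrace`), `….congr_ae_slice` (`…ForcedCongr`), `energy_eq_of_representative`,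
`representative_zero_ae_eq`, `continuousOn_mFourierCoeff_of_weaklyContinuous`
(`PassiveScalarDiagEnergyRepresentative`), `integrableOn_toReal_eScalarGradNormSqDiag`,
`integrableOn_integral_source_mul`, `Torus.IsL2ContinuousOn` (+ `.memLp/.tendsto/.mono`).
Mathlib: `integral_mul_norm_le_Lp_mul_Lq`, `intervalIntegral.continuousOn_primitive`.

## References

* R. Temam, *Navier–Stokes Equations* (North-Holland 1979), Ch. III §1, Lemma 1.2. [`Temam1979`]
* H. Brezis, *Functional Analysis, Sobolev Spaces and PDE* (Springer 2011), Prop. 3.32. [`Brezis2011`]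
* P. Bonicatto, G. Ciampa, G. Crippa, J. Evol. Equ. 24 (2024), Paper No. 1, Thm. 3.3, (3.4),
  Remark 3.4. [`BonicattoCiampaCrippa2023`]
* E. Hess-Childs, K. Rowan, arXiv:2501.18526 (2025), Thm. 1.1 ("the unique solution `θ^κ`"),
  App. A. [`HessChildsRowan2025a`]
-/

noncomputable section

open _root_.MeasureTheory _root_.Set _root_.Filter _root_.Function _root_.TopologicalSpace
open scoped ENNReal NNReal InnerProductSpace ContDiff Topology
open Literature.Analysis.FunctionSpaces.Torus Literature.Analysis.FunctionSpaces UnitAddTorus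

namespace Literature.Analysis.FluidPDE

variable {d : Type*} [Fintype d] [DecidableEq d]

namespace Torus

/-! ## `L²` tools: Cauchy–Schwarz, strong ⇒ weak continuity, Radon–Riesz -/

section L2Tools

omit [DecidableEq d] in
/-- Cauchy–Schwarz in `L²(T^d)`: `|∫ f g| ≤ √(∫ f²) √(∫ g²)`. [folklore] -/
private theorem abs_integral_mul_le_sqrt_sq {f g : UnitAddTorus d → ℝ} (hf : MemLp f 2 volume)
    (hg : MemLp g 2 volume) :
    |∫ x, f x * g x| ≤ Real.sqrt (∫ x, f x ^ 2) * Real.sqrt (∫ x, g x ^ 2) := by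
  have hf' : MemLp f (ENNReal.ofReal 2) volume := by rwa [ENNReal.ofReal_ofNat]
  have hg' : MemLp g (ENNReal.ofReal 2) volume := by rwa [ENNReal.ofReal_ofNat]
  have h := integral_mul_norm_le_Lp_mul_Lq (μ := volume) Real.HolderConjugate.two_two hf' hg'
  have e2 : ∀ (w : UnitAddTorus d → ℝ), (∫ a, ‖w a‖ ^ (2 : ℝ)) ^ (1 / (2 : ℝ)) = Real.sqrt (∫ a, w a ^ 2) := by
    intro w
    rw [Real.sqrt_eq_rpow]
    congr 1
    refine integral_congr_ae (Eventually.of_forall fun a => ?_)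
    dsimp only
    rw [Real.rpow_two, Real.norm_eq_abs, sq_abs]
  rw [e2, e2] at h
  refine le_trans ?_ h
  calc |∫ x, f x * g x| ≤ ∫ x, |f x * g x| := abs_integral_le_integral_abs
    _ = ∫ x, ‖f x‖ * ‖g x‖ := integral_congr_ae (Eventually.of_forall fun x => by
        simp [abs_mul, Real.norm_eq_abs])

omit [DecidableEq d] in
/-- `∫ (f - g)² = ∫ f² - 2 ∫ f g + ∫ g²` in `L²(T^d)`. [folklore] -/
private theorem integral_sub_sq_expand {f g : UnitAddTorus d → ℝ} (hf : MemLp f 2 volume) (hg : MemLp g 2 volume) :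
    ∫ x, (f x - g x) ^ 2 = (∫ x, f x ^ 2) - 2 * (∫ x, f x * g x) + ∫ x, g x ^ 2 := by
  have hfg : Integrable (fun x => 2 * (f x * g x)) volume := (hf.integrable_mul hg).const_mul 2
  have hf2 : Integrable (fun x => f x ^ 2) volume := hf.integrable_sq
  have hg2 : Integrable (fun x => g x ^ 2) volume := hg.integrable_sq
  have h12 : Integrable (fun x => f x ^ 2 - 2 * (f x * g x)) volume := hf2.sub hfg
  have e : (fun x => (f x - g x) ^ 2) = fun x => (f x ^ 2 - 2 * (f x * g x)) + g x ^ 2 := by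
    funext x; ring
  rw [e, integral_add h12 hg2, integral_sub hf2 hfg, integral_const_mul]

omit [DecidableEq d] in
/-- **Strong `L²` continuity implies weak continuity**: for `θ ∈ C(S; L²)` and `g ∈ L²(T^d)`,
`t ↦ ∫ θ(t) g` is continuous on `S` (Cauchy–Schwarz:
`|∫ (θ(t) - θ(t₀)) g| ≤ ‖θ(t) - θ(t₀)‖ ‖g‖`). [cite: Brezis2011, Prop. 3.5 (iii)] -/
theorem IsL2ContinuousOn.continuousOn_integral_mul {S : Set ℝ} {θ : ℝ → UnitAddTorus d → ℝ}
    (h : IsL2ContinuousOn S θ) {g : UnitAddTorus d → ℝ} (hg : MemLp g 2 volume) :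
    ContinuousOn (fun t => ∫ x, θ t x * g x) S := by
  intro t₀ ht₀
  rw [ContinuousWithinAt, tendsto_iff_norm_sub_tendsto_zero]
  have h0 : Tendsto (fun t => Real.sqrt (Torus.scalarL2Sq (θ t - θ t₀)) * Real.sqrt (∫ x, g x ^ 2))
      (𝓝[S] t₀) (𝓝 0) := by
    have := ((Real.continuous_sqrt.tendsto 0).comp (h.tendsto ht₀)).mul_const (Real.sqrt (∫ x, g x ^ 2))
    rwa [Real.sqrt_zero, zero_mul] at this
  refine squeeze_zero_norm' ?_ h0
  filter_upwards [self_mem_nhdsWithin] with t ht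
  have hsub : MemLp (θ t - θ t₀) 2 volume := (h.memLp ht).sub (h.memLp ht₀)
  have i1 : Integrable (fun x => θ t x * g x) volume := (h.memLp ht).integrable_mul hg
  have i2 : Integrable (fun x => θ t₀ x * g x) volume := (h.memLp ht₀).integrable_mul hg
  have e : (∫ x, θ t x * g x) - ∫ x, θ t₀ x * g x = ∫ x, (θ t - θ t₀) x * g x := by
    rw [← integral_sub i1 i2]
    refine integral_congr_ae (ae_of_all _ fun x => ?_)
    simp only [Pi.sub_apply]
    ring
  rw [norm_norm, Real.norm_eq_abs, e]
  have h1 := abs_integral_mul_le_sqrt_sq hsub hg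
  simpa only [Torus.scalarL2Sq, Pi.sub_apply] using h1

omit [DecidableEq d] in
/-- **The energy of a `C(S; L²)` field is continuous**: `t ↦ ∫ θ(t)²` is continuous on `S`
(`∫ θ(t)² = ∫ (θ(t) - θ(t₀))² + 2∫ θ(t) θ(t₀) - ∫ θ(t₀)²`). [cite: Brezis2011, Prop. 3.32] -/
theorem IsL2ContinuousOn.continuousOn_integral_sq {S : Set ℝ} {θ : ℝ → UnitAddTorus d → ℝ}
    (h : IsL2ContinuousOn S θ) : ContinuousOn (fun t => ∫ x, θ t x ^ 2) S := by
  intro t₀ ht₀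
  have hP := h.continuousOn_integral_mul (h.memLp ht₀) t₀ ht₀
  have hlim : Tendsto (fun t => Torus.scalarL2Sq (θ t - θ t₀) + 2 * (∫ x, θ t x * θ t₀ x) - ∫ x, θ t₀ x ^ 2)
      (𝓝[S] t₀) (𝓝 (0 + 2 * (∫ x, θ t₀ x * θ t₀ x) - ∫ x, θ t₀ x ^ 2)) :=
    ((h.tendsto ht₀).add (hP.const_mul 2)).sub tendsto_const_nhds
  have e0 : (0 : ℝ) + 2 * (∫ x, θ t₀ x * θ t₀ x) - ∫ x, θ t₀ x ^ 2 = ∫ x, θ t₀ x ^ 2 := by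
    have : ∫ x, θ t₀ x * θ t₀ x = ∫ x, θ t₀ x ^ 2 := integral_congr_ae (ae_of_all _ fun x => by ring)
    rw [this]; ring
  rw [e0] at hlim
  refine hlim.congr' ?_
  filter_upwards [self_mem_nhdsWithin] with t ht
  have ex := integral_sub_sq_expand (h.memLp ht) (h.memLp ht₀)
  simp only [Torus.scalarL2Sq, Pi.sub_apply]
  rw [ex]
  ring

omit [DecidableEq d] in
/-- **Radon–Riesz in `L²(T^d)`, along a set of times**: a field with `L²` slices on `S` which is
weakly continuous on `S` (`t ↦ ∫ w(t) g` continuous for every `g ∈ L²`) and whose energy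
`t ↦ ∫ w(t)²` is continuous on `S` is STRONGLY continuous, `w ∈ C(S; L²)`
(`‖w(t) - w(t₀)‖² = ‖w(t)‖² - 2⟨w(t), w(t₀)⟩ + ‖w(t₀)‖² → 0`). [cite: Brezis2011, Prop. 3.32] -/
theorem isL2ContinuousOn_of_weaklyContinuous {S : Set ℝ} {w : ℝ → UnitAddTorus d → ℝ}
    (hw2 : ∀ t ∈ S, MemLp (w t) 2 volume)
    (hwc : ∀ g : UnitAddTorus d → ℝ, MemLp g 2 volume → ContinuousOn (fun t => ∫ x, w t x * g x) S)
    (hE : ContinuousOn (fun t => ∫ x, w t x ^ 2) S) : IsL2ContinuousOn S w := by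
  refine ⟨hw2, fun t₀ ht₀ => ?_⟩
  have hP := hwc (w t₀) (hw2 t₀ ht₀) t₀ ht₀
  have hlim : Tendsto (fun t => (∫ x, w t x ^ 2) - 2 * (∫ x, w t x * w t₀ x) + ∫ x, w t₀ x ^ 2)
      (𝓝[S] t₀) (𝓝 ((∫ x, w t₀ x ^ 2) - 2 * (∫ x, w t₀ x * w t₀ x) + ∫ x, w t₀ x ^ 2)) :=
    (((hE t₀ ht₀).sub (hP.const_mul 2)).add tendsto_const_nhds)
  have e0 : (∫ x, w t₀ x ^ 2) - 2 * (∫ x, w t₀ x * w t₀ x) + ∫ x, w t₀ x ^ 2 = 0 := by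
    have : ∫ x, w t₀ x * w t₀ x = ∫ x, w t₀ x ^ 2 := integral_congr_ae (ae_of_all _ fun x => by ring)
    rw [this]; ring
  rw [e0] at hlim
  refine hlim.congr' ?_
  filter_upwards [self_mem_nhdsWithin] with t ht
  simp only [Torus.scalarL2Sq, Pi.sub_apply]
  exact (integral_sub_sq_expand (hw2 t ht) (hw2 t₀ ht₀)).symm

omit [DecidableEq d] in
/-- Modifying a `C(S; L²)` field by a.e.-equal slices keeps it in `C(S; L²)` (all quantities are
integrals of the slices). [folklore] -/
private theorem IsL2ContinuousOn.congr_ae_slice' {S : Set ℝ} {θ θ' : ℝ → UnitAddTorus d → ℝ}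
    (h : IsL2ContinuousOn S θ) (hae : ∀ t ∈ S, θ' t =ᵐ[volume] θ t) : IsL2ContinuousOn S θ' := by
  refine ⟨fun t ht => (h.1 t ht).ae_eq (hae t ht).symm, fun t₀ ht₀ => ?_⟩
  refine (h.2 t₀ ht₀).congr' ?_
  filter_upwards [self_mem_nhdsWithin] with t ht
  refine integral_congr_ae ?_
  filter_upwards [hae t ht, hae t₀ ht₀] with x hx hx₀
  simp only [Pi.sub_apply, hx, hx₀]

end L2Tools

namespace IsWeakScalarTransportDiagForcedOn

variable {T κ : ℝ} {a : d → ℝ} {u : ℝ → UnitAddTorus d → EuclideanSpace ℝ d} {s : ℝ → UnitAddTorus d → ℝ}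
  {θ₀ : UnitAddTorus d → ℝ} {θ : ℝ → UnitAddTorus d → ℝ}

/-! ## The energy equality at every time for `L²`-continuous weak solutions -/

/-- **An `L²`-continuous weak solution takes the datum at `t = 0`**: if `θ ∈ C([0,T]; L²)` then
`θ(0) = θ₀` a.e. (its Fourier coefficients are continuous on `[0,T]` and agree a.e. with the
absolutely continuous pairings of the equation, whose value at `0` is `θ̂₀`).
[cite: Temam1979, Ch. III §1 Lemma 1.2] -/
theorem zero_ae_eq_of_isL2ContinuousOn (h : IsWeakScalarTransportDiagForcedOn T a κ u s θ₀ θ)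
    (hT : 0 < T) (hθ₀ : MemLp θ₀ 2 volume) (hc : IsL2ContinuousOn (Icc 0 T) θ) :
    θ 0 =ᵐ[volume] θ₀ :=
  h.representative_zero_ae_eq hT hθ₀ (hc.memLp (left_mem_Icc.2 hT.le))
    (ae_of_all _ fun _ => EventuallyEq.rfl)
    (continuousOn_mFourierCoeff_of_weaklyContinuous hc.1 fun _ hg => hc.continuousOn_integral_mul hg)

/-- **Energy equality at EVERY time for an `L²`-continuous weak solution.** For `κ > 0`,
`aᵢ > 0`, `θ₀ ∈ L²`, `u ∈ L^∞`, `∫₀ᵀ‖s‖_{L²} < ∞`, a weak solution `θ` of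
`∂ₜθ + u·∇θ = κ ∑ᵢ aᵢ ∂ᵢ∂ᵢθ + s` on `T^d × [0,T)` which is `L²`-continuous on `[0,T]`
(`Torus.IsL2ContinuousOn (Icc 0 T) θ`) satisfies, for EVERY `t ∈ [0,T]`,
`‖θ(t)‖²_{L²} + 2κ ∫₀ᵗ ‖∇θ‖²_a = ‖θ₀‖²_{L²} + 2∫₀ᵗ ∫ s θ` (`‖∇θ‖²_a = Torus.eScalarGradNormSqDiag a θ`;
Bonicatto–Ciampa–Crippa 2024 Thm. 3.3 / (3.4) / Remark 3.4, time-pointwise as in Temam 1979,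
Ch. III §1 Lemma 1.2). [cite: BonicattoCiampaCrippa2023, Thm. 3.3, (3.4) and Remark 3.4] -/
theorem energy_eq_of_isL2ContinuousOn (h : IsWeakScalarTransportDiagForcedOn T a κ u s θ₀ θ)
    (hT : 0 < T) (hκ : 0 < κ) (ha : ∀ i, 0 < a i) (hθ₀ : MemLp θ₀ 2 volume)
    (hu : MemLp (stLift u) ⊤ (volume.restrict (Ioo 0 T ×ˢ univ)))
    (hs : ∫⁻ t in Ioo 0 T, (∫⁻ x, ‖s t x‖ₑ ^ 2) ^ (1 / 2 : ℝ) < ⊤) (hc : IsL2ContinuousOn (Icc 0 T) θ) :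
    ∀ t ∈ Icc 0 T,
      (∫ x, θ t x ^ 2) + 2 * κ * (∫⁻ τ in Ioo 0 t, Torus.eScalarGradNormSqDiag a (θ τ)).toReal =
        (∫ x, θ₀ x ^ 2) + 2 * ∫ τ in Ioo 0 t, ∫ x, s τ x * θ τ x :=
  h.energy_eq_of_representative hT hκ ha hθ₀ hu hs hc.1 (ae_of_all _ fun _ => EventuallyEq.rfl)
    (continuousOn_mFourierCoeff_of_weaklyContinuous hc.1 fun _ hg => hc.continuousOn_integral_mul hg)

/-- **Energy equality between EVERY pair of times for an `L²`-continuous weak solution**: for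
`0 ≤ t₁ ≤ t₂ ≤ T`, `‖θ(t₂)‖²_{L²} + 2κ ∫_{t₁}^{t₂} ‖∇θ‖²_a = ‖θ(t₁)‖²_{L²} + 2 ∫_{t₁}^{t₂} ∫ s θ` —
the energy dissipated on a window equals the energy drop plus the work of the source
(Bonicatto–Ciampa–Crippa 2024, Thm. 3.3 (3.4), Remark 3.4; DEIJ 2022 (1.2)–(1.3)), by subtracting
`energy_eq_of_isL2ContinuousOn` at `t₁` from the one at `t₂`.
[cite: BonicattoCiampaCrippa2023, Thm. 3.3, (3.4) and Remark 3.4] -/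
theorem energy_eq_sub_of_isL2ContinuousOn (h : IsWeakScalarTransportDiagForcedOn T a κ u s θ₀ θ)
    (hT : 0 < T) (hκ : 0 < κ) (ha : ∀ i, 0 < a i) (hθ₀ : MemLp θ₀ 2 volume)
    (hu : MemLp (stLift u) ⊤ (volume.restrict (Ioo 0 T ×ˢ univ)))
    (hs : ∫⁻ t in Ioo 0 T, (∫⁻ x, ‖s t x‖ₑ ^ 2) ^ (1 / 2 : ℝ) < ⊤) (hc : IsL2ContinuousOn (Icc 0 T) θ)
    {t₁ t₂ : ℝ} (ht₁ : 0 ≤ t₁) (h12 : t₁ ≤ t₂) (ht₂ : t₂ ≤ T) :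
    (∫ x, θ t₂ x ^ 2) + 2 * κ * (∫⁻ τ in Ioo t₁ t₂, Torus.eScalarGradNormSqDiag a (θ τ)).toReal =
      (∫ x, θ t₁ x ^ 2) + 2 * ∫ τ in Ioo t₁ t₂, ∫ x, s τ x * θ τ x := by
  have hE := h.energy_eq_of_isL2ContinuousOn hT hκ ha hθ₀ hu hs hc
  have hfin := h.lintegral_eScalarGradNormSqDiag_lt_top hκ ha hθ₀ hu hs
  have hsI := h.integrableOn_integral_source_mul hs
  have e₁ := hE t₁ ⟨ht₁, h12.trans ht₂⟩
  have e₂ := hE t₂ ⟨ht₁.trans h12, ht₂⟩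
  rcases ht₁.eq_or_lt with h0 | h0
  · -- `t₁ = 0`
    subst h0
    have hz : ∫ x, θ 0 x ^ 2 = ∫ x, θ₀ x ^ 2 :=
      integral_congr_ae ((h.zero_ae_eq_of_isL2ContinuousOn hT hθ₀ hc).mono fun x hx => by simp only [hx])
    rw [hz]
    exact e₂
  have hdisj : Disjoint (Ioo 0 t₁) (Ico t₁ t₂) :=
    (Iio_disjoint_Ici le_rfl).mono Ioo_subset_Iio_self Ico_subset_Ici_self
  have hunion : Ioo 0 t₁ ∪ Ico t₁ t₂ = Ioo 0 t₂ := Ioo_union_Ico_eq_Ioo h0 h12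
  have hsub₂ : Ioo 0 t₂ ⊆ Ioo 0 T := Ioo_subset_Ioo_right ht₂
  -- splitting the dissipation
  have hL : ∫⁻ τ in Ioo 0 t₂, Torus.eScalarGradNormSqDiag a (θ τ) =
      (∫⁻ τ in Ioo 0 t₁, Torus.eScalarGradNormSqDiag a (θ τ)) +
        ∫⁻ τ in Ioo t₁ t₂, Torus.eScalarGradNormSqDiag a (θ τ) := by
    rw [← hunion, lintegral_union measurableSet_Ico hdisj,
      setLIntegral_congr (Ioo_ae_eq_Ico : Ioo t₁ t₂ =ᵐ[volume] Ico t₁ t₂)]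
  have hL₂ : ∫⁻ τ in Ioo 0 t₂, Torus.eScalarGradNormSqDiag a (θ τ) ≠ ⊤ :=
    ((lintegral_mono_set hsub₂).trans_lt hfin).ne
  have hL₁ : ∫⁻ τ in Ioo 0 t₁, Torus.eScalarGradNormSqDiag a (θ τ) ≠ ⊤ :=
    ne_top_of_le_ne_top hL₂ (by rw [hL]; exact le_self_add)
  have hL₁₂ : ∫⁻ τ in Ioo t₁ t₂, Torus.eScalarGradNormSqDiag a (θ τ) ≠ ⊤ :=
    ne_top_of_le_ne_top hL₂ (by rw [hL]; exact le_add_self)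
  -- splitting the source work
  have hI : ∫ τ in Ioo 0 t₂, ∫ x, s τ x * θ τ x =
      (∫ τ in Ioo 0 t₁, ∫ x, s τ x * θ τ x) + ∫ τ in Ioo t₁ t₂, ∫ x, s τ x * θ τ x := by
    rw [← hunion, setIntegral_union hdisj measurableSet_Ico
      (hsI.mono_set (Ioo_subset_Ioo_right (h12.trans ht₂)))
      (hsI.mono_set fun τ hτ => ⟨h0.trans_le hτ.1, hτ.2.trans_le ht₂⟩),
      setIntegral_congr_set (Ioo_ae_eq_Ico : Ioo t₁ t₂ =ᵐ[volume] Ico t₁ t₂)]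
  rw [hL, ENNReal.toReal_add hL₁ hL₁₂, hI] at e₂
  linarith

/-! ## Every weak solution has the strongly `L²`-continuous representative -/

/-- **Every weak passive scalar with constant diagonal diffusion, bounded drift and an `L¹_t L²_x`
source is a `C([0,T]; L²)` solution after modification on a null set of times.** For `T > 0`,
`κ > 0`, `aᵢ > 0`, `θ₀ ∈ L²(T^d)`, `u ∈ L^∞((0,T) × T^d)` (weakly divergence free for a.e. `t`,
part of the class), `∫₀ᵀ ‖s(t)‖_{L²} dt < ∞`, and every weak solution `θ` of
`∂ₜθ + u·∇θ = κ ∑ᵢ aᵢ ∂ᵢ∂ᵢθ + s` on `T^d × [0,T)` (`Torus.IsWeakScalarTransportDiagForcedOn`), there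
is a weak solution `w` of the same problem with `w(t) = θ(t)` a.e. for a.e. `t ∈ (0,T)`,
`w(0) = θ₀`, STRONGLY `L²`-continuous on `[0,T]` (`Torus.IsL2ContinuousOn (Icc 0 T) w`, the binder
"the unique solution `θ^κ ∈ C([0,T]; L²)`" of the Hess-Childs–Rowan statements), and satisfying the
energy EQUALITY between every pair of times `0 ≤ t₁ ≤ t₂ ≤ T`:
`‖w(t₂)‖²_{L²} + 2κ ∫_{t₁}^{t₂} ‖∇w‖²_a = ‖w(t₁)‖²_{L²} + 2 ∫_{t₁}^{t₂} ∫ s w`.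
This is Temam 1979, Ch. III §1, Lemma 1.2 (`u ∈ L²(0,T;V)`, `u' ∈ L²(0,T;V')` ⇒ `u ∈ C([0,T];H)`
with `d/dt |u|² = 2⟨u',u⟩`) for this class: the weakly continuous representative
(`exists_weaklyContinuous_representative`) satisfies the energy equality at every time
(`energy_eq_of_representative`), so its energy is continuous, and the Radon–Riesz property of
`L²` (`isL2ContinuousOn_of_weaklyContinuous`, Brezis 2011 Prop. 3.32) gives strong continuity;
the slice at `t = 0` is then set equal to `θ₀` (it equals `θ₀` a.e.). [cite: Temam1979, Ch. III §1 Lemma 1.2] -/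
theorem exists_l2Continuous_representative [Nonempty d] (h : IsWeakScalarTransportDiagForcedOn T a κ u s θ₀ θ)
    (hT : 0 < T) (hκ : 0 < κ) (ha : ∀ i, 0 < a i) (hθ₀ : MemLp θ₀ 2 volume)
    (hu : MemLp (stLift u) ⊤ (volume.restrict (Ioo 0 T ×ˢ univ)))
    (hs : ∫⁻ t in Ioo 0 T, (∫⁻ x, ‖s t x‖ₑ ^ 2) ^ (1 / 2 : ℝ) < ⊤) :
    ∃ w : ℝ → UnitAddTorus d → ℝ,
      IsWeakScalarTransportDiagForcedOn T a κ u s θ₀ w ∧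
      IsL2ContinuousOn (Icc 0 T) w ∧ w 0 = θ₀ ∧
      (∀ᵐ t ∂(volume.restrict (Ioo 0 T)), w t =ᵐ[volume] θ t) ∧
      ∀ ⦃t₁ t₂ : ℝ⦄, 0 ≤ t₁ → t₁ ≤ t₂ → t₂ ≤ T →
        (∫ x, w t₂ x ^ 2) + 2 * κ * (∫⁻ τ in Ioo t₁ t₂, Torus.eScalarGradNormSqDiag a (w τ)).toReal =
          (∫ x, w t₁ x ^ 2) + 2 * ∫ τ in Ioo t₁ t₂, ∫ x, s τ x * w τ x := by
  obtain ⟨v, hvm, hv2, ⟨C, hvC⟩, hvae, hvc, -⟩ := h.exists_weaklyContinuous_representative hT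
  -- continuity of the Fourier coefficients, energy equality at every time, continuity of the energy
  have hv2' : ∀ t ∈ Icc 0 T, MemLp (v t) 2 volume := fun t ht => hv2 t ht.1
  have hvcoef := continuousOn_mFourierCoeff_of_weaklyContinuous hv2' hvc
  have hEv := h.energy_eq_of_representative hT hκ ha hθ₀ hu hs hv2' hvae hvcoef
  obtain ⟨hDint, hDeq⟩ := h.integrableOn_toReal_eScalarGradNormSqDiag hκ ha hθ₀ hu hs
  have hsI := h.integrableOn_integral_source_mul hs
  have hR : ContinuousOn (fun t => (∫ x, θ₀ x ^ 2) + 2 * (∫ τ in Ioc 0 t, ∫ x, s τ x * θ τ x) -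
      2 * κ * ∫ τ in Ioc 0 t, (Torus.eScalarGradNormSqDiag a (θ τ)).toReal) (Icc 0 T) :=
    (continuousOn_const.add (continuousOn_const.mul
      (intervalIntegral.continuousOn_primitive (hsI.congr_set_ae Ioo_ae_eq_Icc.symm)))).sub
      (continuousOn_const.mul (intervalIntegral.continuousOn_primitive (hDint.congr_set_ae Ioo_ae_eq_Icc.symm)))
  have hE : ContinuousOn (fun t => ∫ x, v t x ^ 2) (Icc 0 T) := by
    refine hR.congr fun t ht => ?_
    have e := hEv t ht
    rw [← hDeq t ht.2, setIntegral_congr_set (Ioo_ae_eq_Ioc (μ := (volume : Measure ℝ)) (a := 0) (b := t)),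
      setIntegral_congr_set (Ioo_ae_eq_Ioc (μ := (volume : Measure ℝ)) (a := 0) (b := t))] at e
    show ∫ x, v t x ^ 2 = _
    linarith
  have hvL2 : IsL2ContinuousOn (Icc 0 T) v := isL2ContinuousOn_of_weaklyContinuous hv2' hvc hE
  -- `v` is a weak solution, and `v 0 = θ₀` a.e.
  have hv0 : v 0 =ᵐ[volume] θ₀ :=
    h.representative_zero_ae_eq hT hθ₀ (hv2 0 le_rfl) hvae hvcoef
  -- the modified field
  set w : ℝ → UnitAddTorus d → ℝ := Function.update v 0 θ₀ with hw
  have hw_of_ne : ∀ {t : ℝ}, t ≠ 0 → w t = v t := fun ht => by rw [hw, Function.update_of_ne ht]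
  have hw0 : w 0 = θ₀ := by rw [hw, Function.update_self]
  have hwv : ∀ t ∈ Icc 0 T, w t =ᵐ[volume] v t := by
    intro t ht
    rcases eq_or_ne t 0 with rfl | hne
    · rw [hw0]; exact hv0.symm
    · rw [hw_of_ne hne]
  have hwae : ∀ᵐ t ∂(volume.restrict (Ioo 0 T)), w t =ᵐ[volume] θ t := by
    filter_upwards [hvae, ae_restrict_mem measurableSet_Ioo] with t ht htI
    rw [hw_of_ne htI.1.ne']
    exact ht
  have hwm : AEStronglyMeasurable (stLift w) (volume.restrict (Ioo 0 T ×ˢ univ)) := by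
    refine (hvm.mono_measure (Measure.restrict_mono (Set.prod_mono Ioo_subset_Ioi_self le_rfl) le_rfl)).congr ?_
    filter_upwards [ae_restrict_mem (measurableSet_Ioo.prod MeasurableSet.univ)] with p hp
    obtain ⟨t, y⟩ := p
    simp only [FunctionSpaces.Torus.stLift_apply, hw_of_ne (mem_prod.1 hp).1.1.ne']
  have hwsol : IsWeakScalarTransportDiagForcedOn T a κ u s θ₀ w := h.congr_ae_slice hwm hwae
  have hwL2 : IsL2ContinuousOn (Icc 0 T) w := hvL2.congr_ae_slice' hwv
  refine ⟨w, hwsol, hwL2, hw0, hwae, fun t₁ t₂ ht₁ h12 ht₂ => ?_⟩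
  have key := hwsol.energy_eq_sub_of_isL2ContinuousOn hT hκ ha hθ₀ hu hs hwL2 ht₁ h12 ht₂
  exact key

end IsWeakScalarTransportDiagForcedOn

end Torus

end Literature.Analysis.FluidPDE

end
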